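import Literature.Computability.QuantumComplexity.PolynomialMethod
import Literature.Computability.QuantumComplexity.ExactQuantumQuery
import Literature.Computability.Complexity.ApproximateDegreeDuality
import HarnessLib

/-!
# Exact quantum search needs `N` queries: `Q_E(OR_N) = N` (Beals–Buhrman–Cleve–Mosca–de Wolf, Prop. 6.1 / Cor. 6.2)

Topic `Computability/QuantumComplexity`. R. Beals, H. Buhrman, R. Cleve, M. Mosca, R. de Wolf,
*Quantum lower bounds by polynomials*, J. ACM 48 (2001) 778–797 = FOCS 1998 = arXiv:quant-ph/9802049
[BealsEtAl2001], §6 (held text `paper:arxiv-quant-ph_9802049`, p. 12):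

> Now suppose we want to get rid of the probability of error: can we compute the OR exactly or with
> zero-error using `O(√N)` queries? If not, can quantum computation give us at least some advantage
> over the classical deterministic case? Both questions have a negative answer:
> **Proposition 6.1.** `Q_0(OR) = N`.
> *Proof.* Consider a network that computes OR with zero-error using `T = Q_0(OR)` queries. By
> Lemma 4.1, there are complex-valued polynomials `p_k` of degree at most `T`, such that the final
> state of the network on black-box `X` is `|φ^X⟩ = Σ_{k∈K} p_k(X)|k⟩`. Let `B` be the set of all basis
> states ending in `10` (i.e., where the output is the answer 0). Then for every `k ∈ B` we must have
> `p_k(X) = 0` if `X ≠ 0⃗ = (0,…,0)`, otherwise the probability of getting the incorrect answer `0` on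
> `|φ^X⟩` would be non-zero. On the other hand, there must be at least one `k' ∈ B` such that
> `p_{k'}(0⃗) ≠ 0`, since the probability of getting the correct answer `0` on `|φ^{0⃗}⟩` must be
> non-zero. Let `p(X)` be the real part of `1 − p_{k'}(X)/p_{k'}(0⃗)`. This polynomial `p` has degree
> at most `T` and represents OR. But then `p` must have degree at least `deg(OR) = N`, so `T ≥ N`. □
> **Corollary 6.2.** A quantum network for exact or zero-error search requires `N` queries.
> (p. 12, L22–48.)

## What is typed, and in which model

The tree's query model `Literature.Computability.Cryptography.QQueryAlg` (`QuantumQuery.lean`) has a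
Boolean output (accept / reject) and the error-`ε` notion `ComputesWithError ε`; the EXACT measure
`Q_E(f)` is `quantumQueryComplexity 0 f` (§2: "in the exact setting, an algorithm is required to
return `f(X)` with certainty"). The three-outcome ZERO-ERROR (Las Vegas) model `Q_0` of the printed
proposition ("the probability of getting 'inconclusive' should be less than `1/2`", §2 p. 6) is NOT a
tree object, so what is typed here is the proposition's EXACT case, i.e. the printed Corollary 6.2
for exact search: `Q_E(OR_N) = N`. The printed proof goes through verbatim with `B` := the
non-accepting basis states, using the AMPLITUDE degree bound of Lemma 4.1 (tree:
`hasDegreeLE_finalState`, degree `≤ T` — not the acceptance polynomial's `2T` of Lemma 4.2, which only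
gives `N ≤ 2·Q_E(OR_N)`, the form certified in `Literature/Barriers/PQCSecurity/ParityTestFloor.lean`
as `ExactSearchFloor`), and the step "`p` represents (a nonzero multiple of) `1 − OR`, hence has degree
`N`" is the Fourier fact that a cube function of degree `≤ N − 1` is annihilated by the top character
`χ_{[N]}(x) = (−1)^{|x|}` (tree: `HasPureHighDegree.sum_mul_eq_zero` with character orthogonality
`sum_walsh_mul_walsh_index`), while `Σ_x (−1)^{|x|} p(x) = p(0⃗) ≠ 0` for a function supported on
`{0⃗}`.

* `hasDegreeLE_re_finalState` / `hasDegreeLE_im_finalState` — Lemma 4.1 read on the cube: the real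
  and imaginary parts of every final amplitude `x ↦ ⟨s|φ^x⟩` of a `T`-query algorithm have multilinear
  degree `≤ T` (`Literature.Combinatorics.Optimization.HasDegreeLE`, the cube-degree notion of the
  tree's approximate-degree files; `Multilinear.boolPt = cubePoint` definitionally).
* `sum_mul_walsh_univ_eq_zero` — a cube function of degree `≤ d` with `d < N` satisfies
  `Σ_x p(x)·χ_{[N]}(x) = 0`.
* `acceptProb_add_rejectMass`, `finalState_eq_zero_of_acceptProb_eq_one`,
  `exists_finalState_ne_zero_of_acceptProb_eq_zero` — the Born-rule bookkeeping of the printed proof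
  ("for every `k ∈ B` we must have `p_k(X) = 0` …"; "there must be at least one `k' ∈ B` such that
  `p_{k'}(0⃗) ≠ 0`").
* **`le_queries_of_computesWithError_zero_orFn`** — every algorithm computing `OR_N` with error `0`
  on all inputs makes at least `N` queries.
* **`quantumQueryComplexity_zero_orFn`** — `Q_E(OR_N) = N` (the upper bound is the tree's `N`-query
  exact algorithm, `quantumQueryComplexity_le_holds`); `le_quantumQueryComplexity_zero_orFn` is the
  floor half `N ≤ Q_E(OR_N)` in the shape of `ParityTestFloor.ExactSearchFloor` without the factor `2`.

Everything is proved; no named facts, no new definitions.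

## References

* [BealsEtAl2001] R. Beals, H. Buhrman, R. Cleve, M. Mosca, R. de Wolf, *Quantum lower bounds by
  polynomials*, J. ACM 48(4) (2001) 778–797; arXiv:quant-ph/9802049, §2 (models `Q_E`, `Q_0`, `Q_2`,
  p. 6 L40–45), Lemma 4.1 (p. 7 L12), Prop. 6.1 and Cor. 6.2 (p. 12 L22–48).
* H. Buhrman, R. de Wolf, *Complexity measures and decision tree complexity: a survey*, Theoret.
  Comput. Sci. 288 (2002), §3 (`Q_E(OR_N) = N` quoted). [Wolf2002]
-/

noncomputable section

open Finset
open Literature.Computability.Cryptography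
open Literature.Computability.Complexity
open Literature.Probability.RandomGraphs.LowDegree (walsh sgn)
open Literature.Computability.Complexity.LowDegree (sum_walsh_mul_walsh_index)
open Literature.Combinatorics.Optimization (cubePoint)
open Literature.Computability.Complexity.ApproximateDegree (HasPureHighDegree)

namespace Literature.Computability.QuantumComplexity.ExactSearch

variable {N : ℕ}

/-! ### Lemma 4.1 on the cube: real and imaginary parts of the amplitudes -/

/-- The real part of a final amplitude of a `T`-query algorithm has multilinear degree `≤ T` on the
cube ("there are complex-valued polynomials `p_k` of degree at most `T` such that the final state …
is `Σ p_k(X)|k⟩`"; split into real and imaginary parts as in Lemma 4.2).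
[cite: BealsEtAl2001, Lemma 4.1] -/
theorem hasDegreeLE_re_finalState (A : QQueryAlg N) (s : Fin N × Bool × A.W) :
    Literature.Combinatorics.Optimization.HasDegreeLE A.queries fun x => (A.finalState x s).re := by
  obtain ⟨P, Q, hP, -, h⟩ := hasDegreeLE_finalState A s
  refine ⟨P, hP, fun x => ?_⟩
  have hx := h x
  beta_reduce at hx
  show MvPolynomial.eval (cubePoint x) P = (A.finalState x s).re
  rw [hx]
  simp only [Complex.add_re, Complex.ofReal_re, Complex.mul_re, Complex.I_re, Complex.I_im,
    Complex.ofReal_im, mul_zero, zero_mul, sub_zero, add_zero]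
  rfl

/-- The imaginary part of a final amplitude of a `T`-query algorithm has multilinear degree `≤ T` on
the cube. [cite: BealsEtAl2001, Lemma 4.1] -/
theorem hasDegreeLE_im_finalState (A : QQueryAlg N) (s : Fin N × Bool × A.W) :
    Literature.Combinatorics.Optimization.HasDegreeLE A.queries fun x => (A.finalState x s).im := by
  obtain ⟨P, Q, -, hQ, h⟩ := hasDegreeLE_finalState A s
  refine ⟨Q, hQ, fun x => ?_⟩
  have hx := h x
  beta_reduce at hx
  show MvPolynomial.eval (cubePoint x) Q = (A.finalState x s).im
  rw [hx]
  simp only [Complex.add_im, Complex.ofReal_im, Complex.mul_im, Complex.I_re, Complex.I_im,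
    Complex.ofReal_re, mul_one, mul_zero, add_zero, zero_add]
  rfl

/-! ### `deg = N`: the top character annihilates every function of degree `< N` -/

/-- The top Walsh character `χ_{[N]}(x) = ∏ᵢ (−1)^{xᵢ}` has pure high degree `d` for every `d < N`
(orthogonality of characters). [cite: BealsEtAl2001, §3 ("`deg(OR) = N`")] -/
theorem hasPureHighDegree_walsh_univ {d : ℕ} (hd : d < N) :
    HasPureHighDegree d (fun x : Fin N → Bool => walsh univ x) := by
  intro S hS
  have hSne : (univ : Finset (Fin N)) ≠ S := by
    intro h
    rw [← h, Finset.card_univ, Fintype.card_fin] at hS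
    omega
  rw [sum_walsh_mul_walsh_index, if_neg hSne]

/-- A cube function of multilinear degree `≤ d < N` is annihilated by the top character:
`Σ_x p(x)·(−1)^{|x|} = 0` — the content of "`p` must have degree at least `deg(OR) = N`".
[cite: BealsEtAl2001, Prop. 6.1 (proof, last step)] -/
theorem sum_mul_walsh_univ_eq_zero {d : ℕ} (hd : d < N) {p : (Fin N → Bool) → ℝ}
    (hp : Literature.Combinatorics.Optimization.HasDegreeLE d p) :
    ∑ x, p x * walsh univ x = 0 :=
  (hasPureHighDegree_walsh_univ hd).sum_mul_eq_zero hp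

/-- The top character at the all-zero input is `1` (plumbing). [folklore] -/
private theorem walsh_univ_zero : walsh (univ : Finset (Fin N)) (fun _ : Fin N => false) = 1 := by
  simp [walsh, sgn]

/-- A function supported on `{0⃗}` pairs with the top character to its value at `0⃗`.
[cite: BealsEtAl2001, Prop. 6.1 (proof)] -/
theorem sum_mul_walsh_univ_of_support {p : (Fin N → Bool) → ℝ}
    (hp : ∀ x, x ≠ (fun _ => false) → p x = 0) :
    ∑ x, p x * walsh univ x = p (fun _ => false) := by
  rw [Finset.sum_eq_single (fun _ : Fin N => false)]
  · rw [walsh_univ_zero, mul_one]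
  · intro x _ hx
    rw [hp x hx, zero_mul]
  · intro h
    exact absurd (Finset.mem_univ _) h

/-! ### Born-rule bookkeeping: accepting and rejecting mass -/

open Classical in
/-- Accepting plus non-accepting Born mass is the squared norm of the final state, `= 1`.
[cite: BealsEtAl2001, §2] -/
theorem acceptProb_add_rejectMass (A : QQueryAlg N) (x : Fin N → Bool) :
    A.acceptProb x + ∑ s with s ∉ A.accept, ‖A.finalState x s‖ ^ 2 = 1 := by
  unfold QQueryAlg.acceptProb
  rw [Finset.sum_filter_add_sum_filter_not]
  exact sum_norm_sq_finalState A x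

open Classical in
/-- "For every `k ∈ B` we must have `p_k(X) = 0` … otherwise the probability of getting the incorrect
answer `0` … would be non-zero": if the acceptance probability on `x` is `1`, every non-accepting
amplitude vanishes at `x`. [cite: BealsEtAl2001, Prop. 6.1 (proof)] -/
theorem finalState_eq_zero_of_acceptProb_eq_one (A : QQueryAlg N) {x : Fin N → Bool}
    (hx : 1 ≤ A.acceptProb x) {s : Fin N × Bool × A.W} (hs : s ∉ A.accept) :
    A.finalState x s = 0 := by
  have htot := acceptProb_add_rejectMass A x
  have hrej : ∑ t with t ∉ A.accept, ‖A.finalState x t‖ ^ 2 = 0 := by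
    have h0 : 0 ≤ ∑ t with t ∉ A.accept, ‖A.finalState x t‖ ^ 2 :=
      Finset.sum_nonneg fun _ _ => by positivity
    linarith
  have hterm := (Finset.sum_eq_zero_iff_of_nonneg (fun t _ => by positivity)).1 hrej s
    (Finset.mem_filter.2 ⟨Finset.mem_univ _, hs⟩)
  have hn : ‖A.finalState x s‖ = 0 := by
    have := sq_eq_zero_iff.1 hterm
    exact this
  exact norm_eq_zero.1 hn

open Classical in
/-- "There must be at least one `k' ∈ B` such that `p_{k'}(0⃗) ≠ 0`, since the probability of getting
the correct answer `0` … must be non-zero": if the acceptance probability on `x` is `0`, some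
non-accepting amplitude is nonzero at `x`. [cite: BealsEtAl2001, Prop. 6.1 (proof)] -/
theorem exists_finalState_ne_zero_of_acceptProb_eq_zero (A : QQueryAlg N) {x : Fin N → Bool}
    (hx : A.acceptProb x ≤ 0) : ∃ s, s ∉ A.accept ∧ A.finalState x s ≠ 0 := by
  have htot := acceptProb_add_rejectMass A x
  have hacc : 0 ≤ A.acceptProb x := A.acceptProb_nonneg x
  have hrej : ∑ t with t ∉ A.accept, ‖A.finalState x t‖ ^ 2 ≠ 0 := by
    intro h0
    linarith
  obtain ⟨s, hs, hne⟩ := Finset.exists_ne_zero_of_sum_ne_zero hrej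
  refine ⟨s, (Finset.mem_filter.1 hs).2, fun h0 => hne ?_⟩
  rw [h0, norm_zero, sq, mul_zero]

/-! ### Proposition 6.1 / Corollary 6.2, exact case -/

/-- `OR_N` is true exactly off the all-zero input. [cite: BealsEtAl2001, §6] -/
theorem orFn_eq_true_of_ne {x : Fin N → Bool} (hx : x ≠ fun _ => false) : orFn N x = true := by
  rw [orFn_eq_true_iff]
  by_contra hnone
  push Not at hnone
  exact hx (funext fun i => Bool.eq_false_iff.2 (hnone i))

/-- `OR_N(0⃗) = false`. [cite: BealsEtAl2001, §6] -/
theorem orFn_zero : orFn N (fun _ => false) = false := by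
  rw [← Bool.not_eq_true, orFn_eq_true_iff]
  simp

/-- **Beals–Buhrman–Cleve–Mosca–de Wolf, Prop. 6.1 / Cor. 6.2 (exact search).** Every quantum query
algorithm that computes `OR_N` with error `0` on all `N`-bit inputs makes at least `N` queries. (The
printed proof, with `B` = the non-accepting basis states and the amplitude polynomials of Lemma 4.1;
the zero-error `Q_0` version is not typed — the tree's model has no "inconclusive" outcome.)
[cite: BealsEtAl2001, Prop. 6.1 and Cor. 6.2] -/
theorem le_queries_of_computesWithError_zero_orFn (A : QQueryAlg N)
    (hA : A.ComputesWithError 0 Set.univ (orFn N)) : N ≤ A.queries := by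
  rcases Nat.lt_or_ge A.queries N with hlt | hge
  swap
  · exact hge
  exfalso
  set z : Fin N → Bool := fun _ => false with hz
  -- off `0⃗` the answer is `1` with certainty, so every non-accepting amplitude vanishes there
  have hvan : ∀ x : Fin N → Bool, x ≠ z → ∀ s, s ∉ A.accept → A.finalState x s = 0 := by
    intro x hx s hs
    have h1 : 1 - (0 : ℝ) ≤ A.acceptProb x := (hA x (Set.mem_univ x)).1 (orFn_eq_true_of_ne hx)
    exact finalState_eq_zero_of_acceptProb_eq_one A (by simpa using h1) hs
  -- at `0⃗` the answer is `0` with certainty, so some non-accepting amplitude is nonzero there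
  have h0 : A.acceptProb z ≤ 0 := (hA z (Set.mem_univ z)).2 orFn_zero
  obtain ⟨s, hs, hne⟩ := exists_finalState_ne_zero_of_acceptProb_eq_zero A h0
  -- that amplitude, as a function of the input, is supported on `{0⃗}` and has degree `≤ T < N`:
  -- pairing with the top character gives its value at `0⃗`, and also `0`
  have hre : (A.finalState z s).re = 0 := by
    have h := sum_mul_walsh_univ_eq_zero hlt (hasDegreeLE_re_finalState A s)
    rw [sum_mul_walsh_univ_of_support (fun x hx => by
      show (A.finalState x s).re = 0
      rw [hvan x hx s hs, Complex.zero_re])] at h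
    exact h
  have him : (A.finalState z s).im = 0 := by
    have h := sum_mul_walsh_univ_eq_zero hlt (hasDegreeLE_im_finalState A s)
    rw [sum_mul_walsh_univ_of_support (fun x hx => by
      show (A.finalState x s).im = 0
      rw [hvan x hx s hs, Complex.zero_im])] at h
    exact h
  exact hne (Complex.ext hre him)

/-- **`N ≤ Q_E(OR_N)`** — the floor half of Cor. 6.2 for the tree's exact measure
`quantumQueryComplexity 0` (compare `Literature.Barriers.PQCSecurity.ParityTestFloor.ExactSearchFloor`,
`N ≤ 2·Q_E(OR_N)`, obtained from the degree-`2T` acceptance polynomial).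
[cite: BealsEtAl2001, Cor. 6.2] -/
theorem le_quantumQueryComplexity_zero_orFn (N : ℕ) : N ≤ quantumQueryComplexity 0 (orFn N) := by
  rcases Nat.eq_zero_or_pos N with rfl | hN
  · exact Nat.zero_le _
  · haveI : NeZero N := NeZero.of_pos hN
    obtain ⟨A, hq, hA⟩ :=
      exists_queries_eq_quantumQueryComplexityOn (N := N) (le_refl (0 : ℝ)) Set.univ (orFn N)
    change N ≤ quantumQueryComplexityOn 0 Set.univ (orFn N)
    rw [← hq]
    exact le_queries_of_computesWithError_zero_orFn A hA

/-- **`Q_E(OR_N) = N`** (Beals et al., Prop. 6.1 / Cor. 6.2 in the exact model; the upper bound is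
the `N`-query exact algorithm of the tree, "`N` queries always suffice, even classically").
[cite: BealsEtAl2001, Prop. 6.1 and Cor. 6.2] -/
theorem quantumQueryComplexity_zero_orFn (N : ℕ) : quantumQueryComplexity 0 (orFn N) = N :=
  le_antisymm (quantumQueryComplexity_le_holds 0 le_rfl (orFn N))
    (le_quantumQueryComplexity_zero_orFn N)

end Literature.Computability.QuantumComplexity.ExactSearch

end
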